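import Literature.Computability.AlgebraicComplexity.BigCoppersmithWinograd
import HarnessLib

/-!
# The level-1 laser method for the Coppersmith–Winograd tensor `CW_q`: Kronecker powers restrict
to direct sums of matrix multiplication tensors (CW 1990 §7; BCS 1997 §15.8; ADVXXZ 2025 §3.7) — proved

Topic `Literature/Computability/AlgebraicComplexity`.  Tensor-algebra half of the second application
of the laser method theorem (Bürgisser–Clausen–Shokrollahi 1997, Thm. 15.41) — to the (big)
Coppersmith–Winograd tensor `CW_q = bigCwTensor K q` on `Fin (q+2)` (`x₀ y₀ z_{q+1} + x₀ y_{q+1} z₀ +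
x_{q+1} y₀ z₀ + ∑ᵢ (x₀ yᵢ zᵢ + xᵢ y₀ zᵢ + xᵢ yᵢ z₀)`), which gives `ω < 2.39` (BCS Cor. 15.45;
Coppersmith–Winograd 1990, §7).  This is the **level-1 partition** of Alman–Duan–Vassilevska
Williams–Xu–Xu–Zhou 2025, §3.7: the indices `{0, …, q+1}` are split into the levels
`X₀ = {0}`, `X₁ = {1, …, q}`, `X₂ = {q+1}` (`cwLevel`), the constituent tensor `T_{ijk}` is non-zero
iff `i + j + k = 2` (`bigCwTensor_level_sum`), `CW_q = ∑_{i+j+k=2} T_{ijk}` with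
`T₀₁₁ ≃ ⟨1,1,q⟩, T₁₀₁ ≃ ⟨q,1,1⟩, T₁₁₀ ≃ ⟨1,q,1⟩, T₀₀₂ ≃ T₀₂₀ ≃ T₂₀₀ ≃ ⟨1,1,1⟩` (BCS p. 384); the
blocks of `CW_q^{⊗N}` are indexed by level sequences `I, J, L ∈ {0,1,2}^N` (ADVXXZ §3.8), non-zero
only if `I_t + J_t + L_t = 2` for all `t` (`bigCw_block_support`), and such a block with `a` positions
of each of the patterns `(1,1,0), (0,1,1), (1,0,1)` is the matrix multiplication tensor
`⟨q^a, q^a, q^a⟩` (`bigCw_block_diag`; BCS p. 381: `t^{⊗N}(x,y,z) ≃ ⊗_ρ t(x_ρ,y_ρ,z_ρ)`).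
Consequently (`bigCw_kroneckerPow_blocks`), for every *free diagonal* `Δ` of such level triples
(no triple `(I_δ, J_δ', L_δ'')` mixing members of `Δ` is supported other than trivially), zeroing out
and relabelling turns `CW_q^{⊗N}` into `⟨|Δ|⟩ ⊗ ⟨q^a, q^a, q^a⟩` EXACTLY:
`⟨|Δ|⟩ ⊗ ⟨q^a,q^a,q^a⟩ = CW_q^{⊗N} ∘ (F × G × H)` for explicit index maps — the restriction
`⊕_Δ t^{⊗N}(x,y,z) ≤ t^{⊗N}` of BCS p. 381 in coordinates.  This file is the `CW_q`-analogue of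
`CwLaserBlocks.lean` (little tensor `T_cw,q`, levels `{0,1}`); one definition (`cwLevel`) is introduced.

## References

* D. Coppersmith, S. Winograd, *Matrix multiplication via arithmetic progressions*, J. Symbolic
  Comput. 9 (1990) 251–280, §7. [CoppersmithWinograd1990]
* P. Bürgisser, M. Clausen, M. A. Shokrollahi, *Algebraic Complexity Theory* (1997), §15.6
  (pp. 370–373), Thm. 15.41 and its proof (pp. 380–383), second application p. 384 (Cor. 15.45).
  [BurgisserClausenShokrollahi1997]
* J. Alman, R. Duan, V. Vassilevska Williams, Y. Xu, Z. Xu, R. Zhou, *More asymmetry yields faster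
  matrix multiplication*, SODA 2025 = arXiv:2404.16349, §3.6–§3.8 (level-1 partition of `CW_q` and of
  its tensor powers). [AlmanDuanVassilevskaWilliamsXuXuZhou2025]
-/

noncomputable section

open scoped BigOperators
open Finset

namespace Literature.Computability.AlgebraicComplexity

open Literature.Barriers.MatrixMultiplication (bigCwTensor bigCwTensor_apply bigCwTensor_corner)

universe u

/-! ## Levels of the indices of `CW_q` -/

section Level

variable {q : ℕ}

/-- The **level** of an index of `CW_q`: `0 ↦ 0`, `1, …, q ↦ 1`, `q + 1 ↦ 2` (the level-1 partition
`X = X₀ ⊔ X₁ ⊔ X₂ = {x₀} ⊔ {x₁,…,x_q} ⊔ {x_{q+1}}`). [cite: AlmanDuanVassilevskaWilliamsXuXuZhou2025, §3.7 (Level-1 Partition)] -/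
def cwLevel (a : Fin (q + 2)) : ℕ :=
  if a = 0 then 0 else if a = Fin.last (q + 1) then 2 else 1

/-- `x₀` has level `0`. [cite: AlmanDuanVassilevskaWilliamsXuXuZhou2025, §3.7] -/
@[simp] theorem cwLevel_zero : cwLevel (0 : Fin (q + 2)) = 0 := by
  simp [cwLevel]

/-- `x_{q+1}` has level `2`. [cite: AlmanDuanVassilevskaWilliamsXuXuZhou2025, §3.7] -/
@[simp] theorem cwLevel_last : cwLevel (Fin.last (q + 1)) = 2 := by
  have h : Fin.last (q + 1) ≠ 0 := by simp [Fin.ext_iff]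
  simp [cwLevel, h]

/-- The middle indices have level `1`. [cite: AlmanDuanVassilevskaWilliamsXuXuZhou2025, §3.7] -/
@[simp] theorem cwLevel_mid (i : Fin q) : cwLevel (cwMid i) = 1 := by
  simp [cwLevel, cwMid_ne_zero, cwMid_ne_last]

/-- Level `0` characterises `x₀`. [folklore] -/
theorem cwLevel_eq_zero_iff (a : Fin (q + 2)) : cwLevel a = 0 ↔ a = 0 := by
  induction a using cwCases with
  | zero => simp
  | mid i => simp [cwMid_ne_zero]
  | last => simp [Fin.ext_iff]

/-- Level `2` characterises `x_{q+1}`. [folklore] -/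
theorem cwLevel_eq_two_iff (a : Fin (q + 2)) : cwLevel a = 2 ↔ a = Fin.last (q + 1) := by
  induction a using cwCases with
  | zero => simp [Fin.ext_iff]
  | mid i => simp [cwMid_ne_last]
  | last => simp

/-- Level `1` characterises the middle indices. [folklore] -/
theorem cwLevel_eq_one_iff (a : Fin (q + 2)) : cwLevel a = 1 ↔ ∃ i : Fin q, a = cwMid i := by
  induction a using cwCases with
  | zero =>
      simp only [cwLevel_zero, zero_ne_one, false_iff, not_exists]
      exact fun i => zero_ne_cwMid i
  | mid i => simp only [cwLevel_mid, true_iff]; exact ⟨i, rfl⟩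
  | last =>
      simp only [cwLevel_last, OfNat.ofNat_ne_one, false_iff, not_exists]
      exact fun i => last_ne_cwMid i

/-- Levels are at most `2`. [folklore] -/
theorem cwLevel_le_two (a : Fin (q + 2)) : cwLevel a ≤ 2 := by
  unfold cwLevel; split_ifs <;> omega

end Level

/-! ## The support of `CW_q`: `T_{ijk} ≠ 0 ⇒ i + j + k = 2` -/

section Support

variable (K : Type u) [CommSemiring K] {q : ℕ}

/-- **The level-1 constituent tensors `T_{ijk}` of `CW_q` vanish unless `i + j + k = 2`**
(`CW_q = ∑_{i+j+k=2} T_{ijk}`). [cite: AlmanDuanVassilevskaWilliamsXuXuZhou2025, §3.7 (T^{(1)} = CW_q = ∑_{i+j+k=2} T_{i,j,k})] -/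
theorem bigCwTensor_level_sum {a b c : Fin (q + 2)} (h : bigCwTensor K q a b c ≠ 0) :
    cwLevel a + cwLevel b + cwLevel c = 2 := by
  rw [bigCwTensor_apply] at h
  split_ifs at h with hc
  · have hl0 : Fin.last (q + 1) ≠ (0 : Fin (q + 2)) := by simp [Fin.ext_iff]
    rcases hc with ⟨rfl, rfl, h3, h4⟩ | ⟨rfl, rfl, h3, h4⟩ | ⟨rfl, rfl, h3, h4⟩ |
      ⟨rfl, rfl, rfl⟩ | ⟨rfl, rfl, rfl⟩ | ⟨rfl, rfl, rfl⟩ <;> simp [cwLevel, *]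
  · exact absurd rfl h

/-- **Off-diagonal blocks of `CW_q^{⊗N}` vanish** (`supp_{D^{⊗N}} t^{⊗N} = (supp_D t)^N`, BCS
p. 372/381; ADVXXZ §3.8: the level-1 blocks `X_I, Y_J, Z_K` form a non-zero subtensor only if
`I_t + J_t + K_t = 2` for all `t`). [cite: AlmanDuanVassilevskaWilliamsXuXuZhou2025, §3.8] -/
theorem bigCw_block_support {N : ℕ} (x y z : Fin N → Fin (q + 2))
    (hne : ∏ t, bigCwTensor K q (x t) (y t) (z t) ≠ 0) (t : Fin N) :
    cwLevel (x t) + cwLevel (y t) + cwLevel (z t) = 2 :=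
  bigCwTensor_level_sum K fun h => hne (prod_eq_zero (mem_univ t) h)

end Support

/-! ## One diagonal block of `CW_q^{⊗N}` -/

section Block

variable (K : Type u) [CommSemiring K]

/-- **The supported blocks of `CW_q^{⊗N}` are matrix multiplication tensors** (BCS p. 381:
`t^{⊗N}(x,y,z) ≃ ⊗_ρ t(x_ρ,y_ρ,z_ρ)`, with `T₀₁₁ ≃ ⟨1,1,q⟩`, `T₁₀₁ ≃ ⟨q,1,1⟩`, `T₁₁₀ ≃ ⟨1,q,1⟩`,
`T₀₀₂ ≃ T₀₂₀ ≃ T₂₀₀ ≃ ⟨1,1,1⟩`, p. 384): let `I, J, L ∈ {0,1,2}^N` with `I_t + J_t + L_t = 2`, let the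
pattern classes `S₁₁₀ = {I=1,J=1}`, `S₀₁₁ = {I=0,J=1}`, `S₁₀₁ = {I=1,J=0}` have `a` elements each
(enumerations `e₁₁₀, e₀₁₁, e₁₀₁`), and let the indices `x, y, z` have levels `I, J, L` and carry
`κ, ν` (`x`, on `S₁₁₀`, `S₁₀₁`), `κ', μ` (`y`, on `S₁₁₀`, `S₀₁₁`), `μ', ν'` (`z`, on `S₀₁₁`, `S₁₀₁`).
Then `∏_t CW_q(x_t, y_t, z_t) = [κ = κ'] [μ = μ'] [ν = ν']`, the entry of `⟨q^a, q^a, q^a⟩` at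
`((κ,ν),(κ',μ),(μ',ν'))`. [cite: BurgisserClausenShokrollahi1997, Thm. 15.41 (proof, p. 381) and p. 384] -/
theorem bigCw_block_diag {N q a : ℕ} (I J L : Fin N → Fin 3)
    (hsum : ∀ t, (I t : ℕ) + J t + L t = 2)
    (e₁₁₀ : ↥(univ.filter fun t => I t = 1 ∧ J t = 1) ≃ Fin a)
    (e₀₁₁ : ↥(univ.filter fun t => I t = 0 ∧ J t = 1) ≃ Fin a)
    (e₁₀₁ : ↥(univ.filter fun t => I t = 1 ∧ J t = 0) ≃ Fin a)
    (κ ν κ' μ μ' ν' : Fin a → Fin q) (x y z : Fin N → Fin (q + 2))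
    (hx0 : ∀ t, I t = 0 → x t = 0) (hx2 : ∀ t, I t = 2 → x t = Fin.last (q + 1))
    (hx₁₁₀ : ∀ t (h : t ∈ univ.filter fun t => I t = 1 ∧ J t = 1), x t = cwMid (κ (e₁₁₀ ⟨t, h⟩)))
    (hx₁₀₁ : ∀ t (h : t ∈ univ.filter fun t => I t = 1 ∧ J t = 0), x t = cwMid (ν (e₁₀₁ ⟨t, h⟩)))
    (hy0 : ∀ t, J t = 0 → y t = 0) (hy2 : ∀ t, J t = 2 → y t = Fin.last (q + 1))
    (hy₁₁₀ : ∀ t (h : t ∈ univ.filter fun t => I t = 1 ∧ J t = 1), y t = cwMid (κ' (e₁₁₀ ⟨t, h⟩)))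
    (hy₀₁₁ : ∀ t (h : t ∈ univ.filter fun t => I t = 0 ∧ J t = 1), y t = cwMid (μ (e₀₁₁ ⟨t, h⟩)))
    (hz0 : ∀ t, L t = 0 → z t = 0) (hz2 : ∀ t, L t = 2 → z t = Fin.last (q + 1))
    (hz₀₁₁ : ∀ t (h : t ∈ univ.filter fun t => I t = 0 ∧ J t = 1), z t = cwMid (μ' (e₀₁₁ ⟨t, h⟩)))
    (hz₁₀₁ : ∀ t (h : t ∈ univ.filter fun t => I t = 1 ∧ J t = 0), z t = cwMid (ν' (e₁₀₁ ⟨t, h⟩))) :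
    ∏ t, bigCwTensor K q (x t) (y t) (z t) = if κ = κ' ∧ μ = μ' ∧ ν = ν' then 1 else 0 := by
  classical
  set R := (univ.filter fun t : Fin N => ¬ ((I t = 1 ∧ J t = 1) ∨ (I t = 0 ∧ J t = 1) ∨
    (I t = 1 ∧ J t = 0))) with hR
  have hI3 : ∀ t, (I t : ℕ) ≤ 2 := fun t => Nat.lt_succ_iff.1 (I t).2
  have hJ3 : ∀ t, (J t : ℕ) ≤ 2 := fun t => Nat.lt_succ_iff.1 (J t).2
  have hL3 : ∀ t, (L t : ℕ) ≤ 2 := fun t => Nat.lt_succ_iff.1 (L t).2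
  -- the partition of the positions into the three pattern classes and the rest
  have hcov : (univ.filter fun t => I t = 1 ∧ J t = 1) ∪ (univ.filter fun t => I t = 0 ∧ J t = 1) ∪ (univ.filter fun t => I t = 1 ∧ J t = 0) ∪ R = univ := by
    ext t; simp only [hR, mem_union, mem_filter, mem_univ, true_and, iff_true]
    tauto
  have hd1 : Disjoint (univ.filter fun t => I t = 1 ∧ J t = 1) (univ.filter fun t => I t = 0 ∧ J t = 1) := by
    rw [disjoint_filter]; rintro t - ⟨h1, -⟩ ⟨h2, -⟩; rw [h1] at h2; exact absurd h2 (by decide)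
  have hd2 : Disjoint (univ.filter fun t => I t = 1 ∧ J t = 1) (univ.filter fun t => I t = 1 ∧ J t = 0) := by
    rw [disjoint_filter]; rintro t - ⟨-, h1⟩ ⟨-, h2⟩; rw [h1] at h2; exact absurd h2 (by decide)
  have hd3 : Disjoint (univ.filter fun t => I t = 0 ∧ J t = 1) (univ.filter fun t => I t = 1 ∧ J t = 0) := by
    rw [disjoint_filter]; rintro t - ⟨h1, -⟩ ⟨h2, -⟩; rw [h1] at h2; exact absurd h2 (by decide)
  have hd4 : Disjoint ((univ.filter fun t => I t = 1 ∧ J t = 1) ∪ (univ.filter fun t => I t = 0 ∧ J t = 1) ∪ (univ.filter fun t => I t = 1 ∧ J t = 0)) R := by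
    rw [disjoint_left]; intro t ht htR
    simp only [hR, mem_union, mem_filter, mem_univ, true_and] at ht htR
    tauto
  rw [← hcov, prod_union hd4, prod_union (disjoint_union_left.2 ⟨hd2, hd3⟩), prod_union hd1]
  -- the four partial products
  have h110 : ∏ t ∈ (univ.filter fun t => I t = 1 ∧ J t = 1), bigCwTensor K q (x t) (y t) (z t) =
      ∏ r, if κ r = κ' r then (1 : K) else 0 := by
    rw [← prod_coe_sort (univ.filter fun t => I t = 1 ∧ J t = 1)]
    refine Fintype.prod_equiv e₁₁₀ _ _ fun i => ?_
    have hL : L i = 0 := by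
      have h' := (mem_filter.1 i.2).2
      have := hsum i
      rw [h'.1, h'.2] at this
      exact Fin.ext (by simp only [Fin.val_one] at this; simp; omega)
    rw [hx₁₁₀ _ i.2, hy₁₁₀ _ i.2, hz0 _ hL, bigCwTensor_mid_mid_zero]
  have h011 : ∏ t ∈ (univ.filter fun t => I t = 0 ∧ J t = 1), bigCwTensor K q (x t) (y t) (z t) =
      ∏ r, if μ r = μ' r then (1 : K) else 0 := by
    rw [← prod_coe_sort (univ.filter fun t => I t = 0 ∧ J t = 1)]
    refine Fintype.prod_equiv e₀₁₁ _ _ fun i => ?_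
    have h' := (mem_filter.1 i.2).2
    rw [hx0 _ h'.1, hy₀₁₁ _ i.2, hz₀₁₁ _ i.2, bigCwTensor_zero_mid_mid]
  have h101 : ∏ t ∈ (univ.filter fun t => I t = 1 ∧ J t = 0), bigCwTensor K q (x t) (y t) (z t) =
      ∏ r, if ν r = ν' r then (1 : K) else 0 := by
    rw [← prod_coe_sort (univ.filter fun t => I t = 1 ∧ J t = 0)]
    refine Fintype.prod_equiv e₁₀₁ _ _ fun i => ?_
    have h' := (mem_filter.1 i.2).2
    rw [hx₁₀₁ _ i.2, hy0 _ h'.2, hz₁₀₁ _ i.2, bigCwTensor_mid_zero_mid]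
  have hrest : ∏ t ∈ R, bigCwTensor K q (x t) (y t) (z t) = 1 := by
    refine prod_eq_one fun t ht => ?_
    have ht' := (mem_filter.1 ht).2
    have hs := hsum t
    -- one of the three letters is `2`, the others `0`
    have hcase : (I t = 2 ∧ J t = 0 ∧ L t = 0) ∨ (I t = 0 ∧ J t = 2 ∧ L t = 0) ∨
        (I t = 0 ∧ J t = 0 ∧ L t = 2) := by
      have hI := hI3 t; have hJ := hJ3 t; have hL := hL3 t
      simp only [Fin.ext_iff, Fin.val_zero, Fin.val_one, Fin.val_two] at ht' ⊢
      omega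
    rcases hcase with ⟨h1, h2, h3⟩ | ⟨h1, h2, h3⟩ | ⟨h1, h2, h3⟩
    · rw [hx2 _ h1, hy0 _ h2, hz0 _ h3, bigCwTensor_last_zero_zero]
    · rw [hx0 _ h1, hy2 _ h2, hz0 _ h3, bigCwTensor_zero_last_zero]
    · rw [hx0 _ h1, hy0 _ h2, hz2 _ h3, bigCwTensor_corner]
  rw [h110, h011, h101, hrest, mul_one]
  -- a product of indicators is the indicator of the conjunction
  have hone : ∀ u : Fin a → Fin q, ∏ r, (if u r = u r then (1 : K) else 0) = 1 := fun u => by simp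
  have hzero : ∀ u v : Fin a → Fin q, u ≠ v → ∏ r, (if u r = v r then (1 : K) else 0) = 0 := by
    intro u v h
    obtain ⟨r, hr⟩ := Function.ne_iff.1 h
    exact prod_eq_zero (mem_univ r) (if_neg hr)
  by_cases h : κ = κ' ∧ μ = μ' ∧ ν = ν'
  · obtain ⟨rfl, rfl, rfl⟩ := h
    rw [if_pos ⟨rfl, rfl, rfl⟩, hone, hone, hone, one_mul, one_mul]
  · rw [if_neg h]
    by_cases hκ : κ = κ'
    · by_cases hμ : μ = μ'
      · have hν : ν ≠ ν' := fun hν => h ⟨hκ, hμ, hν⟩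
        rw [hzero _ _ hν, mul_zero]
      · rw [hzero _ _ hμ, mul_zero, zero_mul]
    · rw [hzero _ _ hκ, zero_mul, zero_mul]

end Block

/-! ## The Kronecker power restricts to `⟨|Δ|⟩ ⊗ ⟨q^a, q^a, q^a⟩` along a free diagonal -/

section Main

variable (K : Type u) [CommSemiring K]

/-- **Level-1 laser method for `CW_q`, combinatorial-restriction form** (BCS 1997, proof of
Thm. 15.41 applied to `CW_q`, pp. 381–384; CW 1990 §7): let `Δ` be a family of level triples
`(I, J, L) ∈ ({0,1,2}^N)³` with `I_t + J_t + L_t = 2` for all `t`, each with exactly `a` positions of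
each of the patterns `(1,1,0)`, `(0,1,1)`, `(1,0,1)`, which is a *free diagonal*: whenever
`(I_δ, J_δ', L_δ'')` is again supported (`I_δ + J_δ' + L_δ'' ≡ 2`) for `δ, δ', δ'' ∈ Δ`, then
`δ = δ' = δ''`.  Then zeroing out all level-1 blocks of `CW_q^{⊗N}` outside `Δ` and relabelling
leaves exactly `⟨|Δ|⟩ ⊗ ⟨q^a, q^a, q^a⟩`: there are index maps `F, G, H` with
`⟨|Δ|⟩ ⊗ ⟨q^a,q^a,q^a⟩ = CW_q^{⊗N} ∘ (F × G × H)` (BCS p. 381: "`⊕_{(x,y,z)∈Δ} t^{⊗N}(x,y,z) ≤ t^{⊗N}`").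
[cite: BurgisserClausenShokrollahi1997, Thm. 15.41 (proof, p. 381) and p. 384] -/
theorem bigCw_kroneckerPow_blocks (q a N : ℕ)
    (Δ : Finset ((Fin N → Fin 3) × (Fin N → Fin 3) × (Fin N → Fin 3)))
    (hsupp : ∀ δ ∈ Δ, ∀ t, (δ.1 t : ℕ) + δ.2.1 t + δ.2.2 t = 2)
    (hcard : ∀ δ ∈ Δ, (univ.filter fun t => δ.1 t = 1 ∧ δ.2.1 t = 1).card = a ∧
      (univ.filter fun t => δ.1 t = 0 ∧ δ.2.1 t = 1).card = a ∧
      (univ.filter fun t => δ.1 t = 1 ∧ δ.2.1 t = 0).card = a)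
    (hfree : ∀ δ ∈ Δ, ∀ δ' ∈ Δ, ∀ δ'' ∈ Δ,
      (∀ t, (δ.1 t : ℕ) + δ'.2.1 t + δ''.2.2 t = 2) → δ = δ' ∧ δ' = δ'') :
    ∃ (F G H : Fin Δ.card × (Fin (q ^ a) × Fin (q ^ a)) → (Fin N → Fin (q + 2))),
      kroneckerTensor (unitTensor K Δ.card) (matMulTensor K (q ^ a) (q ^ a) (q ^ a)) =
        fun x y z => kroneckerPow (bigCwTensor K q) N (F x) (G y) (H z) := by
  classical
  -- enumerate `Δ`
  let δ : Fin Δ.card → (Fin N → Fin 3) × (Fin N → Fin 3) × (Fin N → Fin 3) :=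
    fun s => (Δ.equivFin.symm s).1
  have hδmem : ∀ s, δ s ∈ Δ := fun s => (Δ.equivFin.symm s).2
  have hδinj : Function.Injective δ := Subtype.val_injective.comp Δ.equivFin.symm.injective
  -- level words and pattern classes of the `s`-th triple
  let I : Fin Δ.card → Fin N → Fin 3 := fun s => (δ s).1
  let J : Fin Δ.card → Fin N → Fin 3 := fun s => (δ s).2.1
  let L : Fin Δ.card → Fin N → Fin 3 := fun s => (δ s).2.2
  have hsum : ∀ s t, (I s t : ℕ) + J s t + L s t = 2 := fun s t => hsupp _ (hδmem s) t
  let S₁₁₀ : Fin Δ.card → Finset (Fin N) := fun s => univ.filter fun t => I s t = 1 ∧ J s t = 1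
  let S₀₁₁ : Fin Δ.card → Finset (Fin N) := fun s => univ.filter fun t => I s t = 0 ∧ J s t = 1
  let S₁₀₁ : Fin Δ.card → Finset (Fin N) := fun s => univ.filter fun t => I s t = 1 ∧ J s t = 0
  let e₁₁₀ : ∀ s, ↥(S₁₁₀ s) ≃ Fin a := fun s => equivFinOfCardEq (hcard _ (hδmem s)).1
  let e₀₁₁ : ∀ s, ↥(S₀₁₁ s) ≃ Fin a := fun s => equivFinOfCardEq (hcard _ (hδmem s)).2.1
  let e₁₀₁ : ∀ s, ↥(S₁₀₁ s) ≃ Fin a := fun s => equivFinOfCardEq (hcard _ (hδmem s)).2.2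
  -- `Fin (q^a)` as functions
  let f : Fin (q ^ a) → Fin a → Fin q := fun k => finFunctionFinEquiv.symm k
  have hf : ∀ k k' : Fin (q ^ a), f k = f k' ↔ k = k' := fun k k' =>
    finFunctionFinEquiv.symm.injective.eq_iff
  -- elementary consequences of `I + J + L = 2`
  have hval : ∀ (u : Fin 3), (u : ℕ) = 0 ∨ (u : ℕ) = 1 ∨ (u : ℕ) = 2 := fun u => by
    have := u.2; omega
  have hmem₁₁₀ : ∀ s t, t ∈ S₁₁₀ s ↔ I s t = 1 ∧ J s t = 1 := fun s t => by simp [S₁₁₀]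
  have hmem₀₁₁ : ∀ s t, t ∈ S₀₁₁ s ↔ I s t = 0 ∧ J s t = 1 := fun s t => by simp [S₀₁₁]
  have hmem₁₀₁ : ∀ s t, t ∈ S₁₀₁ s ↔ I s t = 1 ∧ J s t = 0 := fun s t => by simp [S₁₀₁]
  have hL₁₁₀ : ∀ s t, t ∈ S₁₁₀ s → L s t = 0 := fun s t ht => by
    obtain ⟨h1, h2⟩ := (hmem₁₁₀ s t).1 ht
    have := hsum s t; rw [h1, h2] at this
    exact Fin.ext (by simp at this ⊢; omega)
  have hL₀₁₁ : ∀ s t, t ∈ S₀₁₁ s → L s t = 1 := fun s t ht => by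
    obtain ⟨h1, h2⟩ := (hmem₀₁₁ s t).1 ht
    have := hsum s t; rw [h1, h2] at this
    exact Fin.ext (by simp at this ⊢; omega)
  have hL₁₀₁ : ∀ s t, t ∈ S₁₀₁ s → L s t = 1 := fun s t ht => by
    obtain ⟨h1, h2⟩ := (hmem₁₀₁ s t).1 ht
    have := hsum s t; rw [h1, h2] at this
    exact Fin.ext (by simp at this ⊢; omega)
  -- the index maps
  let F : Fin Δ.card × (Fin (q ^ a) × Fin (q ^ a)) → Fin N → Fin (q + 2) := fun x t =>
    if h : t ∈ S₁₁₀ x.1 then cwMid (f x.2.1 (e₁₁₀ x.1 ⟨t, h⟩))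
    else if h' : t ∈ S₁₀₁ x.1 then cwMid (f x.2.2 (e₁₀₁ x.1 ⟨t, h'⟩))
    else if I x.1 t = 2 then Fin.last (q + 1) else 0
  let G : Fin Δ.card × (Fin (q ^ a) × Fin (q ^ a)) → Fin N → Fin (q + 2) := fun y t =>
    if h : t ∈ S₁₁₀ y.1 then cwMid (f y.2.1 (e₁₁₀ y.1 ⟨t, h⟩))
    else if h' : t ∈ S₀₁₁ y.1 then cwMid (f y.2.2 (e₀₁₁ y.1 ⟨t, h'⟩))
    else if J y.1 t = 2 then Fin.last (q + 1) else 0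
  let H : Fin Δ.card × (Fin (q ^ a) × Fin (q ^ a)) → Fin N → Fin (q + 2) := fun z t =>
    if h : t ∈ S₀₁₁ z.1 then cwMid (f z.2.1 (e₀₁₁ z.1 ⟨t, h⟩))
    else if h' : t ∈ S₁₀₁ z.1 then cwMid (f z.2.2 (e₁₀₁ z.1 ⟨t, h'⟩))
    else if L z.1 t = 2 then Fin.last (q + 1) else 0
  -- levels of the embedded indices
  have hFlev : ∀ x t, cwLevel (F x t) = (I x.1 t : ℕ) := by
    intro x t
    simp only [F]
    by_cases h1 : t ∈ S₁₁₀ x.1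
    · rw [dif_pos h1, cwLevel_mid, ((hmem₁₁₀ _ _).1 h1).1]; rfl
    by_cases h2 : t ∈ S₁₀₁ x.1
    · rw [dif_neg h1, dif_pos h2, cwLevel_mid, ((hmem₁₀₁ _ _).1 h2).1]; rfl
    rw [dif_neg h1, dif_neg h2]
    by_cases h3 : I x.1 t = 2
    · rw [if_pos h3, cwLevel_last, h3]; rfl
    · rw [if_neg h3, cwLevel_zero]
      -- `I ≠ 1` (else `J ∈ {0,1}` would put `t` in a pattern class) and `I ≠ 2`
      have hs := hsum x.1 t
      rw [hmem₁₁₀] at h1; rw [hmem₁₀₁] at h2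
      have hJ := hval (J x.1 t); have hI := hval (I x.1 t); have hL := hval (L x.1 t)
      have h3' : (I x.1 t : ℕ) ≠ 2 := fun h => h3 (Fin.ext h)
      have h1' : ¬ ((I x.1 t : ℕ) = 1 ∧ (J x.1 t : ℕ) = 1) := fun h => h1 ⟨Fin.ext h.1, Fin.ext h.2⟩
      have h2' : ¬ ((I x.1 t : ℕ) = 1 ∧ (J x.1 t : ℕ) = 0) := fun h => h2 ⟨Fin.ext h.1, Fin.ext h.2⟩
      omega
  have hGlev : ∀ y t, cwLevel (G y t) = (J y.1 t : ℕ) := by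
    intro y t
    simp only [G]
    by_cases h1 : t ∈ S₁₁₀ y.1
    · rw [dif_pos h1, cwLevel_mid, ((hmem₁₁₀ _ _).1 h1).2]; rfl
    by_cases h2 : t ∈ S₀₁₁ y.1
    · rw [dif_neg h1, dif_pos h2, cwLevel_mid, ((hmem₀₁₁ _ _).1 h2).2]; rfl
    rw [dif_neg h1, dif_neg h2]
    by_cases h3 : J y.1 t = 2
    · rw [if_pos h3, cwLevel_last, h3]; rfl
    · rw [if_neg h3, cwLevel_zero]
      have hs := hsum y.1 t
      rw [hmem₁₁₀] at h1; rw [hmem₀₁₁] at h2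
      have hJ := hval (J y.1 t); have hI := hval (I y.1 t); have hL := hval (L y.1 t)
      have h3' : (J y.1 t : ℕ) ≠ 2 := fun h => h3 (Fin.ext h)
      have h1' : ¬ ((I y.1 t : ℕ) = 1 ∧ (J y.1 t : ℕ) = 1) := fun h => h1 ⟨Fin.ext h.1, Fin.ext h.2⟩
      have h2' : ¬ ((I y.1 t : ℕ) = 0 ∧ (J y.1 t : ℕ) = 1) := fun h => h2 ⟨Fin.ext h.1, Fin.ext h.2⟩
      omega
  have hHlev : ∀ z t, cwLevel (H z t) = (L z.1 t : ℕ) := by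
    intro z t
    simp only [H]
    by_cases h1 : t ∈ S₀₁₁ z.1
    · rw [dif_pos h1, cwLevel_mid, hL₀₁₁ _ _ h1]; rfl
    by_cases h2 : t ∈ S₁₀₁ z.1
    · rw [dif_neg h1, dif_pos h2, cwLevel_mid, hL₁₀₁ _ _ h2]; rfl
    rw [dif_neg h1, dif_neg h2]
    by_cases h3 : L z.1 t = 2
    · rw [if_pos h3, cwLevel_last, h3]; rfl
    · rw [if_neg h3, cwLevel_zero]
      have hs := hsum z.1 t
      rw [hmem₀₁₁] at h1; rw [hmem₁₀₁] at h2
      have hJ := hval (J z.1 t); have hI := hval (I z.1 t); have hL := hval (L z.1 t)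
      have h3' : (L z.1 t : ℕ) ≠ 2 := fun h => h3 (Fin.ext h)
      have h1' : ¬ ((I z.1 t : ℕ) = 0 ∧ (J z.1 t : ℕ) = 1) := fun h => h1 ⟨Fin.ext h.1, Fin.ext h.2⟩
      have h2' : ¬ ((I z.1 t : ℕ) = 1 ∧ (J z.1 t : ℕ) = 0) := fun h => h2 ⟨Fin.ext h.1, Fin.ext h.2⟩
      omega
  refine ⟨F, G, H, ?_⟩
  funext x y z
  obtain ⟨s, κ, ν⟩ := x
  obtain ⟨s', κ', μ⟩ := y
  obtain ⟨s'', μ', ν'⟩ := z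
  rw [kroneckerTensor_apply, kroneckerPow_apply, unitTensor_apply]
  by_cases hs : s = s' ∧ s' = s''
  · -- a diagonal block: the matrix multiplication tensor
    obtain ⟨rfl, rfl⟩ := hs
    rw [if_pos ⟨rfl, rfl⟩, one_mul]
    have key := bigCw_block_diag K (I s) (J s) (L s) (hsum s) (e₁₁₀ s) (e₀₁₁ s) (e₁₀₁ s)
      (f κ) (f ν) (f κ') (f μ) (f μ') (f ν') (F (s, κ, ν)) (G (s, κ', μ)) (H (s, μ', ν'))
      (fun t ht => by
        have h1 : t ∉ S₁₁₀ s := fun h => by have := ((hmem₁₁₀ _ _).1 h).1; rw [ht] at this; exact absurd this (by decide)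
        have h2 : t ∉ S₁₀₁ s := fun h => by have := ((hmem₁₀₁ _ _).1 h).1; rw [ht] at this; exact absurd this (by decide)
        have h3 : I s t ≠ 2 := by rw [ht]; decide
        simp only [F]; rw [dif_neg h1, dif_neg h2, if_neg h3])
      (fun t ht => by
        have h1 : t ∉ S₁₁₀ s := fun h => by have := ((hmem₁₁₀ _ _).1 h).1; rw [ht] at this; exact absurd this (by decide)
        have h2 : t ∉ S₁₀₁ s := fun h => by have := ((hmem₁₀₁ _ _).1 h).1; rw [ht] at this; exact absurd this (by decide)
        simp only [F]; rw [dif_neg h1, dif_neg h2, if_pos ht])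
      (fun t h => by simp only [F]; rw [dif_pos h])
      (fun t h => by
        have h1 : t ∉ S₁₁₀ s := fun h' => by
          have a1 := ((hmem₁₁₀ _ _).1 h').2; have a2 := ((hmem₁₀₁ _ _).1 h).2
          rw [a1] at a2; exact absurd a2 (by decide)
        simp only [F]; rw [dif_neg h1, dif_pos h])
      (fun t ht => by
        have h1 : t ∉ S₁₁₀ s := fun h => by have := ((hmem₁₁₀ _ _).1 h).2; rw [ht] at this; exact absurd this (by decide)
        have h2 : t ∉ S₀₁₁ s := fun h => by have := ((hmem₀₁₁ _ _).1 h).2; rw [ht] at this; exact absurd this (by decide)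
        have h3 : J s t ≠ 2 := by rw [ht]; decide
        simp only [G]; rw [dif_neg h1, dif_neg h2, if_neg h3])
      (fun t ht => by
        have h1 : t ∉ S₁₁₀ s := fun h => by have := ((hmem₁₁₀ _ _).1 h).2; rw [ht] at this; exact absurd this (by decide)
        have h2 : t ∉ S₀₁₁ s := fun h => by have := ((hmem₀₁₁ _ _).1 h).2; rw [ht] at this; exact absurd this (by decide)
        simp only [G]; rw [dif_neg h1, dif_neg h2, if_pos ht])
      (fun t h => by simp only [G]; rw [dif_pos h])
      (fun t h => by
        have h1 : t ∉ S₁₁₀ s := fun h' => by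
          have a1 := ((hmem₁₁₀ _ _).1 h').1; have a2 := ((hmem₀₁₁ _ _).1 h).1
          rw [a1] at a2; exact absurd a2 (by decide)
        simp only [G]; rw [dif_neg h1, dif_pos h])
      (fun t ht => by
        have h1 : t ∉ S₀₁₁ s := fun h => by have := hL₀₁₁ _ _ h; rw [ht] at this; exact absurd this (by decide)
        have h2 : t ∉ S₁₀₁ s := fun h => by have := hL₁₀₁ _ _ h; rw [ht] at this; exact absurd this (by decide)
        have h3 : L s t ≠ 2 := by rw [ht]; decide
        simp only [H]; rw [dif_neg h1, dif_neg h2, if_neg h3])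
      (fun t ht => by
        have h1 : t ∉ S₀₁₁ s := fun h => by have := hL₀₁₁ _ _ h; rw [ht] at this; exact absurd this (by decide)
        have h2 : t ∉ S₁₀₁ s := fun h => by have := hL₁₀₁ _ _ h; rw [ht] at this; exact absurd this (by decide)
        simp only [H]; rw [dif_neg h1, dif_neg h2, if_pos ht])
      (fun t h => by simp only [H]; rw [dif_pos h])
      (fun t h => by
        have h1 : t ∉ S₀₁₁ s := fun h' => by
          have a1 := ((hmem₀₁₁ _ _).1 h').1; have a2 := ((hmem₁₀₁ _ _).1 h).1
          rw [a1] at a2; exact absurd a2 (by decide)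
        simp only [H]; rw [dif_neg h1, dif_pos h])
    rw [key]
    simp only [matMulTensor]
    by_cases h : κ = κ' ∧ μ = μ' ∧ ν = ν'
    · rw [if_pos h, if_pos ⟨by rw [h.1], by rw [h.2.1], by rw [h.2.2]⟩]
    · rw [if_neg h, if_neg fun h' => h ⟨(hf _ _).1 h'.1, (hf _ _).1 h'.2.1, (hf _ _).1 h'.2.2⟩]
  · -- an off-diagonal block vanishes, by freeness of `Δ`
    rw [if_neg hs, zero_mul]
    by_contra hne
    have hlev := bigCw_block_support K (F (s, κ, ν)) (G (s', κ', μ)) (H (s'', μ', ν')) (Ne.symm hne)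
    have h2 : ∀ t, ((δ s).1 t : ℕ) + (δ s').2.1 t + (δ s'').2.2 t = 2 := fun t => by
      have := hlev t
      rw [hFlev, hGlev, hHlev] at this
      exact this
    obtain ⟨e1, e2⟩ := hfree _ (hδmem s) _ (hδmem s') _ (hδmem s'') h2
    exact hs ⟨hδinj e1, hδinj e2⟩

end Main

end Literature.Computability.AlgebraicComplexity

end
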